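import Summits.Ventures.HodgeRepro2.T5CyclotomicSevenPlaceCensus

/-!
# THE PLACE OF `ℚ(ζ₇)⁺` ABOVE `7`: totally ramified in `ℚ(ζ₇)`, `e(v/7) = 3`, `e(w/v) = 2`, `N(v) = 7`

Tier-5 support N3 / §G-N4.2 (seat p3, gen 79). File 266 is the census of the places of `ℚ(ζ₇)⁺` above the primes
`p ≠ 7`. This file treats the remaining prime: Mathlib's `IsCyclotomicExtension.Rat.ramificationIdx_eq_of_prime` /
`inertiaDeg_eq_of_prime` / `ncard_primesOver_of_prime` give `e(P/7) = 6`, `f(P/7) = 1` and ONE prime `P = (1 − ζ₇)`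
of `ℚ(ζ₇)` above `7`; the Galois fundamental identities on the cubic `ℚ(ζ₇)⁺/ℚ` (`e(v/7) ∣ 3`) and on the quadratic
`ℚ(ζ₇)/ℚ(ζ₇)⁺` (`e(w/v) ∣ 2`) with the tower law `e(v/7) · e(w/v) = 6` force `e(v/7) = 3`, `e(w/v) = 2`; the inertia
degrees are `1`; so `v` is the unique place of `ℚ(ζ₇)⁺` above `7`, `N(v) = 7`, and it is RAMIFIED in `ℚ(ζ₇)` with one
place `w` above it (`v 𝓞_K ≤ w²`) — the one place of the field of record outside the unramified census:

* `ramificationIdx_of_liesOver_seven`, `inertiaDeg_of_liesOver_seven` — `e(P/7) = 6`, `f(P/7) = 1`;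
* `ramificationIdx_dvd_three` — `e(v/7) ∣ 3` (Galois cubic); `ramificationIdx_over_dvd_two` — `e(w/v) ∣ 2`;
* **`ramificationIdx_eq_three`**, **`ramificationIdx_over_eq_two`** — `e(v/7) = 3`, `e(w/v) = 2`;
  `inertiaDeg_eq_one`, `inertiaDeg_over_eq_one` — `f(v/7) = f(w/v) = 1`;
* **`absNorm_eq_seven`** — `N(v) = 7`; **`ncard_primesOver_eq_one`** — one place of `ℚ(ζ₇)` above `v`;
  **`ncard_primesOver_int_eq_one`** — one place of `ℚ(ζ₇)⁺` above `7`; `ramificationIdx'_eq_two`,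
  **`map_le_pow_two`** — `v 𝓞_K ≤ w²`; `exists_liesOver_seven` — the place exists.

§8(d): uses an L-value-free non-vanishing device: NO.
-/

open NumberField NumberField.IsCMField IsDedekindDomain IsDedekindDomain.HeightOneSpectrum Module Polynomial
open Summit.Ventures.HodgeRepro2.T5RecordSatakeInert Summit.Ventures.HodgeRepro2.T5InertDegreeAdicCompletion
  Summit.Ventures.HodgeRepro2.T5FinitePlaceSplitIff Summit.Ventures.HodgeRepro2.T5InertGlobalPrime
  Summit.Ventures.HodgeRepro2.T5FinitePlaceCM Summit.Ventures.HodgeRepro2.T5FinitePlaceNormIndex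
  Summit.Ventures.HodgeRepro2.T5CMFieldSquareDatum Summit.Ventures.HodgeRepro2.T5NonSplitPlaceUnitaryGroup
  Summit.Ventures.HodgeRepro2.T5FinitePlaceLocalDegree Summit.Ventures.HodgeRepro2.T5RecordSatakeIntrinsic
  Summit.Ventures.HodgeRepro2.T5CyclotomicSevenInertThree Summit.Ventures.HodgeRepro2.T5CyclotomicSevenInertPrime
  Summit.Ventures.HodgeRepro2.T5CyclotomicSevenSplitTwo Summit.Ventures.HodgeRepro2.T5CyclotomicSevenSplitPrime
  Summit.Ventures.HodgeRepro2.T5CyclotomicSevenDegreeOnePrime Summit.Ventures.HodgeRepro2.T5CyclotomicSevenPlaceCensus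

namespace Summit.Ventures.HodgeRepro2.T5CyclotomicSevenRamifiedPlace

section Seven

variable (K : Type*) [Field K] [CharZero K] [IsCyclotomicExtension {7} ℚ K]

/-- `(7)` is a prime of `ℤ`. -/
theorem isPrime_span_seven_int : (Ideal.span {((7 : ℕ) : ℤ)}).IsPrime :=
  (Ideal.span_singleton_prime (by norm_num)).mpr (by norm_num)

section Above

variable (P : Ideal (𝓞 K)) [P.IsPrime] [P.LiesOver (Ideal.span {((7 : ℕ) : ℤ)})]

/-- **`e(P/7) = 6`** for the prime of `ℚ(ζ₇)` above `7` (Mathlib's `ramificationIdx_eq_of_prime`). -/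
theorem ramificationIdx_of_liesOver_seven :
    haveI := numberField' K
    P.ramificationIdx ℤ = 6 := by
  haveI := numberField' K
  haveI := fact_prime_seven
  exact IsCyclotomicExtension.Rat.ramificationIdx_eq_of_prime 7 K P

/-- **`f(P/7) = 1`** (Mathlib's `inertiaDeg_eq_of_prime`). -/
theorem inertiaDeg_of_liesOver_seven :
    haveI := numberField' K
    P.inertiaDeg ℤ = 1 := by
  haveI := numberField' K
  haveI := fact_prime_seven
  exact IsCyclotomicExtension.Rat.inertiaDeg_eq_of_prime 7 K P

end Above

section Place

variable (v : HeightOneSpectrum (𝓞 (maximalRealSubfield K))) [hv : v.asIdeal.LiesOver (Ideal.span {((7 : ℕ) : ℤ)})]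
include hv

/-- **`e(v/7) ∣ 3`**: the Galois fundamental identity `g · e · f = 3` on the cubic `ℚ(ζ₇)⁺/ℚ`. -/
theorem ramificationIdx_dvd_three :
    haveI := numberField' K; haveI := isCMField' K
    v.asIdeal.ramificationIdx ℤ ∣ 3 := by
  haveI := numberField' K
  haveI := isCMField' K
  haveI := isGalois_maximalRealSubfield K
  haveI := isPrime_span_seven_int
  have h := Ideal.ncard_primesOver_mul_ramificationIdxIn_mul_inertiaDegIn (Ideal.span {((7 : ℕ) : ℤ)})
    (𝓞 (maximalRealSubfield K)) (maximalRealSubfield K ≃ₐ[ℚ] maximalRealSubfield K)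
  rw [Ideal.ramificationIdxIn_eq_ramificationIdx _ v.asIdeal (maximalRealSubfield K ≃ₐ[ℚ] maximalRealSubfield K),
    IsGaloisGroup.card_eq_finrank (maximalRealSubfield K ≃ₐ[ℚ] maximalRealSubfield K) ℚ (maximalRealSubfield K),
    finrank_rat_maximalRealSubfield_seven K] at h
  exact ⟨((Ideal.span {((7 : ℕ) : ℤ)}).primesOver (𝓞 (maximalRealSubfield K))).ncard *
    (Ideal.span {((7 : ℕ) : ℤ)}).inertiaDegIn (𝓞 (maximalRealSubfield K)), by rw [← h]; ring⟩

variable (w : HeightOneSpectrum (𝓞 K)) [hw : w.asIdeal.LiesOver v.asIdeal]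
include hw

omit hv in
/-- **`e(w/v) ∣ 2`**: the fundamental identity `#{w ∣ v} · e(w/v) · f(w/v) = 2` on `ℚ(ζ₇)/ℚ(ζ₇)⁺`. -/
theorem ramificationIdx_over_dvd_two :
    haveI := numberField' K; haveI := isCMField' K
    w.asIdeal.ramificationIdx (𝓞 (maximalRealSubfield K)) ∣ 2 := by
  haveI := numberField' K
  haveI := isCMField' K
  have h := ncard_primesOver_mul_eq_two K v
  rw [Ideal.ramificationIdxIn_eq_ramificationIdx v.asIdeal w.asIdeal (K ≃ₐ[maximalRealSubfield K] K)] at h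
  exact ⟨(v.asIdeal.primesOver (𝓞 K)).ncard * v.asIdeal.inertiaDegIn (𝓞 K), by rw [← h]; ring⟩

/-- **The tower law `e(v/7) · e(w/v) = e(w/7) = 6`.** -/
theorem ramificationIdx_mul_eq_six :
    haveI := numberField' K; haveI := isCMField' K
    v.asIdeal.ramificationIdx ℤ * w.asIdeal.ramificationIdx (𝓞 (maximalRealSubfield K)) = 6 := by
  haveI := numberField' K
  haveI := isCMField' K
  haveI := T5CyclotomicSevenDegreeOnePrime.liesOver_int K 7 v w
  have htower := Ideal.ramificationIdx_tower (R := ℤ) v.asIdeal w.asIdeal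
  rw [ramificationIdx_of_liesOver_seven K w.asIdeal] at htower
  exact htower.symm

/-- **`e(v/7) = 3`.** -/
theorem ramificationIdx_eq_three :
    haveI := numberField' K; haveI := isCMField' K
    v.asIdeal.ramificationIdx ℤ = 3 := by
  haveI := numberField' K
  haveI := isCMField' K
  have h6 := ramificationIdx_mul_eq_six K v w
  have ha := ramificationIdx_dvd_three K v
  have hb := ramificationIdx_over_dvd_two K v w
  rcases (Nat.dvd_prime Nat.prime_three).mp ha with h | h <;>
    rcases (Nat.dvd_prime Nat.prime_two).mp hb with h' | h' <;> rw [h, h'] at h6 <;> first | exact h | omega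

/-- **`e(w/v) = 2`: the place above `7` RAMIFIES in `ℚ(ζ₇)`.** -/
theorem ramificationIdx_over_eq_two :
    haveI := numberField' K; haveI := isCMField' K
    w.asIdeal.ramificationIdx (𝓞 (maximalRealSubfield K)) = 2 := by
  haveI := numberField' K
  haveI := isCMField' K
  have h6 := ramificationIdx_mul_eq_six K v w
  rw [ramificationIdx_eq_three K v w] at h6
  omega

/-- **The tower law `f(v/7) · f(w/v) = f(w/7) = 1`.** -/
theorem inertiaDeg_mul_eq_one :
    haveI := numberField' K; haveI := isCMField' K
    v.asIdeal.inertiaDeg ℤ * w.asIdeal.inertiaDeg (𝓞 (maximalRealSubfield K)) = 1 := by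
  haveI := numberField' K
  haveI := isCMField' K
  haveI := T5CyclotomicSevenDegreeOnePrime.liesOver_int K 7 v w
  have htower := Ideal.inertiaDeg_tower (R := ℤ) v.asIdeal w.asIdeal
  rw [inertiaDeg_of_liesOver_seven K w.asIdeal] at htower
  exact htower.symm

/-- **`f(v/7) = 1`.** -/
theorem inertiaDeg_eq_one :
    haveI := numberField' K; haveI := isCMField' K
    v.asIdeal.inertiaDeg ℤ = 1 := by
  haveI := numberField' K
  haveI := isCMField' K
  exact Nat.eq_one_of_mul_eq_one_right (inertiaDeg_mul_eq_one K v w)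

/-- **`f(w/v) = 1`.** -/
theorem inertiaDeg_over_eq_one :
    haveI := numberField' K; haveI := isCMField' K
    w.asIdeal.inertiaDeg (𝓞 (maximalRealSubfield K)) = 1 := by
  haveI := numberField' K
  haveI := isCMField' K
  exact Nat.eq_one_of_mul_eq_one_left (inertiaDeg_mul_eq_one K v w)

/-- **`N(v) = 7`.** -/
theorem absNorm_eq_seven :
    haveI := numberField' K; haveI := isCMField' K
    Ideal.absNorm v.asIdeal = 7 := by
  haveI := numberField' K
  haveI := isCMField' K
  have h := Ideal.absNorm_pow_inertiaDeg (Ideal.span {((7 : ℕ) : ℤ)}) v.asIdeal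
  rw [absNorm_span_natCast_int, inertiaDeg_eq_one K v w, pow_one] at h
  exact h.symm

/-- **One place of `ℚ(ζ₇)` above `v`**: `#{w ∣ v} · e(w/v) · f(w/v) = 2` with `e(w/v) = 2`, `f(w/v) = 1`. -/
theorem ncard_primesOver_eq_one :
    haveI := numberField' K; haveI := isCMField' K
    (v.asIdeal.primesOver (𝓞 K)).ncard = 1 := by
  haveI := numberField' K
  haveI := isCMField' K
  have h := ncard_primesOver_mul_eq_two K v
  rw [Ideal.ramificationIdxIn_eq_ramificationIdx v.asIdeal w.asIdeal (K ≃ₐ[maximalRealSubfield K] K),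
    Ideal.inertiaDegIn_eq_inertiaDeg v.asIdeal w.asIdeal (K ≃ₐ[maximalRealSubfield K] K),
    ramificationIdx_over_eq_two K v w, inertiaDeg_over_eq_one K v w, mul_one] at h
  exact Nat.eq_of_mul_eq_mul_right two_pos (h.trans (one_mul 2).symm)

/-- **One place of `ℚ(ζ₇)⁺` above `7`**: the Galois fundamental identity `g · e · f = 3` with `e(v/7) = 3`,
`f(v/7) = 1`. -/
theorem ncard_primesOver_int_eq_one :
    haveI := numberField' K; haveI := isCMField' K
    ((Ideal.span {((7 : ℕ) : ℤ)}).primesOver (𝓞 (maximalRealSubfield K))).ncard = 1 := by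
  haveI := numberField' K
  haveI := isCMField' K
  haveI := isGalois_maximalRealSubfield K
  haveI := isPrime_span_seven_int
  have h := Ideal.ncard_primesOver_mul_ramificationIdxIn_mul_inertiaDegIn (Ideal.span {((7 : ℕ) : ℤ)})
    (𝓞 (maximalRealSubfield K)) (maximalRealSubfield K ≃ₐ[ℚ] maximalRealSubfield K)
  rw [Ideal.inertiaDegIn_eq_inertiaDeg _ v.asIdeal (maximalRealSubfield K ≃ₐ[ℚ] maximalRealSubfield K),
    Ideal.ramificationIdxIn_eq_ramificationIdx _ v.asIdeal (maximalRealSubfield K ≃ₐ[ℚ] maximalRealSubfield K),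
    IsGaloisGroup.card_eq_finrank (maximalRealSubfield K ≃ₐ[ℚ] maximalRealSubfield K) ℚ (maximalRealSubfield K),
    finrank_rat_maximalRealSubfield_seven K, ramificationIdx_eq_three K v w, inertiaDeg_eq_one K v w, mul_one] at h
  omega

/-- **`e'(v/w) = 2`** in the `sSup` form of the ramification index. -/
theorem ramificationIdx'_eq_two :
    haveI := numberField' K; haveI := isCMField' K
    v.asIdeal.ramificationIdx' w.asIdeal = 2 := by
  haveI := numberField' K
  haveI := isCMField' K
  rw [Ideal.ramificationIdx'_eq_ramificationIdx v.asIdeal w.asIdeal v.ne_bot]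
  exact ramificationIdx_over_eq_two K v w

/-- **`v 𝓞_K ≤ w²`**: the place above `7` is ramified in `ℚ(ζ₇)`. -/
theorem map_le_pow_two :
    haveI := numberField' K; haveI := isCMField' K
    Ideal.map (algebraMap (𝓞 (maximalRealSubfield K)) (𝓞 K)) v.asIdeal ≤ w.asIdeal ^ 2 := by
  haveI := numberField' K
  haveI := isCMField' K
  have h := Ideal.le_pow_ramificationIdx' (p := v.asIdeal) (P := w.asIdeal)
  rwa [ramificationIdx'_eq_two K v w] at h

end Place

/-- **The place of `ℚ(ζ₇)⁺` above `7` exists**, has norm `7` and one ramified place of `ℚ(ζ₇)` above it. -/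
theorem exists_liesOver_seven :
    haveI := numberField' K; haveI := isCMField' K
    ∃ v : HeightOneSpectrum (𝓞 (maximalRealSubfield K)), v.asIdeal.LiesOver (Ideal.span {((7 : ℕ) : ℤ)}) ∧
      Ideal.absNorm v.asIdeal = 7 ∧ (v.asIdeal.primesOver (𝓞 K)).ncard = 1 := by
  haveI := numberField' K
  haveI := isCMField' K
  haveI := isPrime_span_seven_int
  obtain ⟨⟨Q, hQ, hQo⟩⟩ := Ideal.nonempty_primesOver (S := 𝓞 (maximalRealSubfield K)) (Ideal.span {((7 : ℕ) : ℤ)})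
  haveI := hQ
  haveI := hQo
  have hne : Q ≠ ⊥ := Ideal.ne_bot_of_liesOver_of_ne_bot
    ((Ideal.span_singleton_eq_bot).not.mpr (by norm_num : ((7 : ℕ) : ℤ) ≠ 0)) Q
  obtain ⟨⟨P, hP, hPo⟩⟩ := Ideal.nonempty_primesOver (S := 𝓞 K) Q
  haveI := hP
  haveI := hPo
  have hPne : P ≠ ⊥ := Ideal.ne_bot_of_liesOver_of_ne_bot hne P
  exact ⟨⟨Q, hQ, hne⟩, hQo, absNorm_eq_seven K ⟨Q, hQ, hne⟩ ⟨P, hP, hPne⟩ (hw := hPo),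
    ncard_primesOver_eq_one K ⟨Q, hQ, hne⟩ ⟨P, hP, hPne⟩ (hw := hPo)⟩

end Seven

end Summit.Ventures.HodgeRepro2.T5CyclotomicSevenRamifiedPlace
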